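import Summits.RiemannHypothesis.RiemannHypothesis.Theorems.JensenPolynomialsFarGumbelJunkRegionB
import Summits.RiemannHypothesis.RiemannHypothesis.Theorems.JensenPolynomialsFarGumbelJunkBudget
import Literature.NumberTheory.LFunctions.DeBruijnPhiLogDerivEnvelope
import Literature.NumberTheory.LFunctions.DeBruijnPhiDecreasing

/-!
# Route `JensenPolynomials`, FAR crux `XiWindowZeroFreeRelFar` (B1-rel far) — line «far-gumbel» (theory g8, skeleton v5),
stub S2 `stub_junk`: the truncation junk is below the envelope (RH-FREE; cell rh-jensen, HUMAN RULING D-0040; item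
`stmt-RiemannHypothesis-19465`)

`‖winI M s − winJ M υ (farA M s)‖ ≤ farEnv M υ (farA M s/υ²)` for `M ≥ 2·10¹⁸`, the far mode `υ` (`4πe^{4υ}υ = 2M + 9υ`,
`υ ≥ 189/20`) and `‖s‖ ≤ (7/20)M` — the registered signature, proved BY NAME (§2). Assembly: the split
`‖I − J‖ ≤ ∫_{(0,υ−2]} Φu^{2M}‖T_M(a/u²)‖ + ∫_{(υ−2,∞)} Φu^{2M}‖T_M(a/u²) − (1+a/u²)^{M−½}‖` (part A, `…JunkSplit`); the region-A
integral (§1 here: `integral_mono_of_nonneg` against the integrable majorant `C₀ + c₄|u − √‖a‖|^{−1/2}` on `(0, υ−2]`, a.e. off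
the point `u = √‖a‖`, from R1 and `junk_pointwise_R2` of part B2) and the region-B integral (part E, `…JunkRegionB`); the
numerical budget (part D, `…JunkBudget.junk_budget`: the six resulting terms sum to at most
`(π²/2)e^{9υ}υ^{2M}‖1+z̃‖^{M−½}e^{−9Λ/8}√(2π/Λ) = farEnv`), with `‖a‖ ≤ 0.3502υ²` (`norm_farA_le`, window law of `…ModeCM`).
§0: two PRIVATE local copies (suffix `_loc`) of lemmas of `…JunkPointwise` (not importable today, see part E's header).

WHAT THIS IS NOT: real-analysis bookkeeping for explicit integrals attached to `ξ`'s Taylor data and the kernel `Φ`; nothing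
here bears on the zeros of `ζ` or the truth of RH. References: [GORZPNAS2019]; theory g8's card `far-gumbel` v5
(crux workfile `Lines/far-gumbel.lean`, sha16 `9e01753b`).
-/

noncomputable section
-- D-0017: `Summit.RiemannHypothesis.RiemannHypothesis.…` duplicates the namespace BY DESIGN (single-problem summit).
set_option linter.dupNamespace false

namespace Summit.RiemannHypothesis.RiemannHypothesis.Theorems.JensenPolynomials.FarGumbel

open Literature.NumberTheory.LFunctions MeasureTheory Set Complex Real
open Summit.RiemannHypothesis.RiemannHypothesis.Theorems.JensenPolynomials.WindowEGF

/-! ## 0. Local copies of `…JunkPointwise` §2, §4 (private, suffix `_loc`) -/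

/-- `Φ ≤ 0.45` on `[0, ∞)` (indeed everywhere). -/
private theorem deBruijnPhi_le_045_loc (u : ℝ) : deBruijnPhi u ≤ 0.45 :=
  (deBruijnPhi_le_deBruijnPhi_zero u).trans deBruijnPhi_zero_le

/-- **R1.** For `0 < u`, `u ≤ (2/5)υ` and `‖a‖ ≤ 0.3502υ²`: `Φ(u)u^{2M}‖T_M(a/u²)‖ ≤ 0.45·(0.5102·υ²)^M`. -/
private theorem junk_pointwise_R1_loc (M : ℕ) {υ u : ℝ} {a : ℂ} (hu : 0 < u) (huυ : u ≤ 2 / 5 * υ)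
    (ha : ‖a‖ ≤ 0.3502 * υ ^ 2) :
    deBruijnPhi u * u ^ (2 * M) *
        ‖∑ k ∈ Finset.range (M + 1),
          ((((descPochhammer ℝ k).eval ((M : ℝ) - 1 / 2) / (Nat.factorial k : ℝ) : ℝ)) : ℂ) * (a / (u : ℂ) ^ 2) ^ k‖ ≤
      0.45 * (0.5102 * υ ^ 2) ^ M := by
  have hT := norm_truncBinom_le M (a / (u : ℂ) ^ 2)
  have hΦ := deBruijnPhi_le_045_loc u
  have hΦ0 := (deBruijnPhi_pos_of_nonneg hu.le).le
  have hw : ‖a / (u : ℂ) ^ 2‖ = ‖a‖ / u ^ 2 := by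
    rw [norm_div, norm_pow, Complex.norm_real, Real.norm_of_nonneg hu.le]
  have hkey : u ^ (2 * M) * (1 + ‖a / (u : ℂ) ^ 2‖) ^ M = (u ^ 2 + ‖a‖) ^ M := by
    rw [hw, pow_mul, ← mul_pow]
    congr 1
    field_simp
  have hbase : u ^ 2 + ‖a‖ ≤ 0.5102 * υ ^ 2 := by nlinarith
  calc deBruijnPhi u * u ^ (2 * M) * _ ≤ deBruijnPhi u * u ^ (2 * M) * (1 + ‖a / (u : ℂ) ^ 2‖) ^ M := by
        apply mul_le_mul_of_nonneg_left hT (mul_nonneg hΦ0 (pow_nonneg hu.le _))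
    _ = deBruijnPhi u * (u ^ 2 + ‖a‖) ^ M := by rw [mul_assoc, hkey]
    _ ≤ 0.45 * (0.5102 * υ ^ 2) ^ M := by
        apply mul_le_mul hΦ (pow_le_pow_left₀ (by positivity) hbase M) (by positivity) (by norm_num)

/-- `‖1 + a/υ²‖ ≥ 0.6498` when `‖a‖ ≤ 0.3502υ²` (`υ > 0`): the lower edge of the disc `‖z̃‖ ≤ 0.3502` used by R3b and by the
`stub_junk` assembly. -/
private theorem norm_one_add_div_sq_ge_loc {υ : ℝ} (hυ : 0 < υ) {a : ℂ} (ha : ‖a‖ ≤ 0.3502 * υ ^ 2) :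
    0.6498 ≤ ‖1 + a / (υ : ℂ) ^ 2‖ := by
  have hυ2 : 0 < υ ^ 2 := by positivity
  have hz : ‖a / (υ : ℂ) ^ 2‖ ≤ 0.3502 := by
    rw [norm_div, norm_pow, Complex.norm_real, Real.norm_of_nonneg hυ.le, div_le_iff₀ hυ2]; linarith
  have h := norm_sub_norm_le (1 : ℂ) (-(a / (υ : ℂ) ^ 2))
  rw [sub_neg_eq_add, norm_neg, norm_one] at h
  linarith

/-! ## 1. Region A: the low integral `∫_{(0, υ−2]}` -/

set_option maxHeartbeats 400000 in
/-- **Region A.** `∫_{(0,υ−2]} Φu^{2M}‖T_M(a/u²)‖ ≤ C₀·(υ−2) + c₄·4√(υ−2)` with the constants of R1/R2. -/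
theorem regionA_bound {M : ℕ} (hM : 1 ≤ M) {υ : ℝ} (hυ : (189 / 20 : ℝ) ≤ υ) {a : ℂ} (ha : ‖a‖ ≤ 0.3502 * υ ^ 2) :
    (∫ u in Set.Ioc (0 : ℝ) (υ - 2), deBruijnPhi u * u ^ (2 * M) *
        ‖∑ k ∈ Finset.range (M + 1),
          ((((descPochhammer ℝ k).eval ((M : ℝ) - 1 / 2) / (Nat.factorial k : ℝ) : ℝ)) : ℂ) * (a / (u : ℂ) ^ 2) ^ k‖) ≤
      (0.45 * (0.5102 * υ ^ 2) ^ M +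
          50 * Real.exp (9 * υ) * υ ^ (2 * M) * ‖1 + a / (υ : ℂ) ^ 2‖ ^ ((M : ℝ) - 1 / 2) *
            (((υ - 2) ^ 2 / υ ^ 2 + 0.3502) / 1.3502) ^ ((M : ℝ) - 1 / 2) +
          0.225 * ‖a‖ ^ (M + 1) * (2 / 5 * υ)⁻¹ ^ 2) * (υ - 2) +
        0.71 * (‖a‖ ^ M * ‖a‖ ^ (3 / 4 : ℝ)) * (2 / 5 * υ)⁻¹ * (4 * Real.sqrt (υ - 2)) := by
  have hυ0 : 0 < υ := by linarith
  have hL : 0 ≤ υ - 2 := by linarith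
  have h25 : 0 < 2 / 5 * υ := by positivity
  have hN0 : 0 ≤ (M : ℝ) - 1 / 2 := by
    have : (1:ℝ) ≤ M := by exact_mod_cast hM
    linarith
  set B : ℝ := 50 * Real.exp (9 * υ) * υ ^ (2 * M) * ‖1 + a / (υ : ℂ) ^ 2‖ ^ ((M : ℝ) - 1 / 2) with hBdef
  set ρm : ℝ := ((υ - 2) ^ 2 / υ ^ 2 + 0.3502) / 1.3502 with hρmdef
  set C₀ : ℝ := 0.45 * (0.5102 * υ ^ 2) ^ M + B * ρm ^ ((M : ℝ) - 1 / 2) + 0.225 * ‖a‖ ^ (M + 1) * (2 / 5 * υ)⁻¹ ^ 2 with hC₀def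
  set c₄ : ℝ := 0.71 * (‖a‖ ^ M * ‖a‖ ^ (3 / 4 : ℝ)) * (2 / 5 * υ)⁻¹ with hc₄def
  set u₀ : ℝ := Real.sqrt ‖a‖ with hu₀def
  have hB0 : 0 ≤ B := by positivity
  have hρm0 : 0 ≤ ρm := by positivity
  have hC₀0 : 0 ≤ C₀ := by positivity
  have hc₄0 : 0 ≤ c₄ := by positivity
  -- the majorant and its integral
  obtain ⟨hhint, hhle⟩ := integral_abs_rpow_neg_half_le u₀ hL
  have hh_int : IntegrableOn (fun u : ℝ ↦ |u - u₀| ^ (-(1 / 2 : ℝ))) (Set.Ioc 0 (υ - 2)) :=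
    (intervalIntegrable_iff_integrableOn_Ioc_of_le hL).mp hhint
  have hconst_int : IntegrableOn (fun _ : ℝ ↦ C₀) (Set.Ioc 0 (υ - 2)) :=
    (continuousOn_const.integrableOn_Icc).mono_set Set.Ioc_subset_Icc_self
  have hm_int : IntegrableOn (fun u : ℝ ↦ C₀ + c₄ * |u - u₀| ^ (-(1 / 2 : ℝ))) (Set.Ioc 0 (υ - 2)) :=
    hconst_int.add (hh_int.const_mul c₄)
  -- the a.e. pointwise bound
  have hae0 : ∀ᵐ u ∂(volume : Measure ℝ), u ∉ ({u₀} : Set ℝ) :=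
    compl_mem_ae_iff.mpr Real.volume_singleton
  have hpt : ∀ᵐ u ∂(volume.restrict (Set.Ioc 0 (υ - 2))),
      deBruijnPhi u * u ^ (2 * M) *
        ‖∑ k ∈ Finset.range (M + 1),
          ((((descPochhammer ℝ k).eval ((M : ℝ) - 1 / 2) / (Nat.factorial k : ℝ) : ℝ)) : ℂ) * (a / (u : ℂ) ^ 2) ^ k‖ ≤
      C₀ + c₄ * |u - u₀| ^ (-(1 / 2 : ℝ)) := by
    rw [ae_restrict_iff' measurableSet_Ioc]
    filter_upwards [hae0] with u hu0 hu
    have hu' : u ≠ u₀ := by simpa using hu0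
    have hupos : 0 < u := hu.1
    have hh0 : 0 ≤ c₄ * |u - u₀| ^ (-(1 / 2 : ℝ)) := mul_nonneg hc₄0 (Real.rpow_nonneg (abs_nonneg _) _)
    rcases le_or_gt u (2 / 5 * υ) with hle | hgt
    · have h1 := junk_pointwise_R1_loc M hupos hle ha
      have : 0.45 * (0.5102 * υ ^ 2) ^ M ≤ C₀ := by
        rw [hC₀def]; nlinarith [mul_nonneg hB0 (Real.rpow_nonneg hρm0 ((M : ℝ) - 1 / 2)), sq_nonneg ((2 / 5 * υ)⁻¹),
          pow_nonneg (norm_nonneg a) (M + 1)]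
      linarith
    · have hne : u ^ 2 ≠ ‖a‖ := by
        intro h
        apply hu'
        rw [hu₀def, ← h, Real.sqrt_sq hupos.le]
      have h2 := junk_pointwise_R2 hM hυ0 hgt.le (by linarith [hu.2]) ha hne
      -- weaken each term
      have hρ : ((u ^ 2 / υ ^ 2 + 0.3502) / 1.3502) ^ ((M : ℝ) - 1 / 2) ≤ ρm ^ ((M : ℝ) - 1 / 2) := by
        apply Real.rpow_le_rpow (by positivity) _ hN0
        rw [hρmdef]
        have h1 : u ^ 2 ≤ (υ - 2) ^ 2 := by nlinarith [hu.2]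
        have hυ2 : 0 < υ ^ 2 := by positivity
        have h2 := div_le_div_of_nonneg_right h1 hυ2.le
        exact div_le_div_of_nonneg_right (by linarith) (by norm_num)
      have hinv : u⁻¹ ≤ (2 / 5 * υ)⁻¹ := inv_anti₀ h25 hgt.le
      have hinv0 : 0 ≤ u⁻¹ := inv_nonneg.mpr hupos.le
      have hinv2 : u⁻¹ ^ 2 ≤ (2 / 5 * υ)⁻¹ ^ 2 := pow_le_pow_left₀ hinv0 hinv 2
      have t1 : 50 * Real.exp (9 * υ) * υ ^ (2 * M) * ‖1 + a / (υ : ℂ) ^ 2‖ ^ ((M : ℝ) - 1 / 2) *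
          ((u ^ 2 / υ ^ 2 + 0.3502) / 1.3502) ^ ((M : ℝ) - 1 / 2) ≤ B * ρm ^ ((M : ℝ) - 1 / 2) :=
        mul_le_mul_of_nonneg_left hρ hB0
      have t2 : 0.225 * ‖a‖ ^ (M + 1) * u⁻¹ ^ 2 ≤ 0.225 * ‖a‖ ^ (M + 1) * (2 / 5 * υ)⁻¹ ^ 2 :=
        mul_le_mul_of_nonneg_left hinv2 (by positivity)
      have t3 : 0.71 * (‖a‖ ^ M * ‖a‖ ^ (3 / 4 : ℝ)) * (u⁻¹ * |u - Real.sqrt ‖a‖| ^ (-(1 / 2 : ℝ))) ≤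
          c₄ * |u - u₀| ^ (-(1 / 2 : ℝ)) := by
        rw [hc₄def, hu₀def, mul_assoc (0.71 * (‖a‖ ^ M * ‖a‖ ^ (3 / 4 : ℝ)))]
        apply mul_le_mul_of_nonneg_left _ (by positivity)
        exact mul_le_mul_of_nonneg_right hinv (Real.rpow_nonneg (abs_nonneg _) _)
      have hK1 : 0 ≤ 0.45 * (0.5102 * υ ^ 2) ^ M := by positivity
      rw [hC₀def]
      linarith
  -- nonnegativity of the integrand on the set
  have hnn : 0 ≤ᵐ[volume.restrict (Set.Ioc 0 (υ - 2))] fun u : ℝ ↦ deBruijnPhi u * u ^ (2 * M) *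
      ‖∑ k ∈ Finset.range (M + 1),
        ((((descPochhammer ℝ k).eval ((M : ℝ) - 1 / 2) / (Nat.factorial k : ℝ) : ℝ)) : ℂ) * (a / (u : ℂ) ^ 2) ^ k‖ := by
    rw [Filter.EventuallyLE, ae_restrict_iff' measurableSet_Ioc]
    refine Filter.Eventually.of_forall fun u hu ↦ ?_
    exact mul_nonneg (mul_nonneg (deBruijnPhi_pos_of_nonneg hu.1.le).le (pow_nonneg hu.1.le _)) (norm_nonneg _)
  -- integrate
  have hmono := integral_mono_of_nonneg hnn hm_int hpt
  refine hmono.trans ?_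
  rw [integral_add hconst_int (hh_int.const_mul c₄), integral_const_mul, setIntegral_const]
  have hvol : (volume : Measure ℝ).real (Set.Ioc 0 (υ - 2)) = υ - 2 := by
    rw [Measure.real, Real.volume_Ioc, ENNReal.toReal_ofReal (by linarith)]; ring
  rw [hvol, ← intervalIntegral.integral_of_le hL]
  have hhle' : (∫ u in (0 : ℝ)..υ - 2, |u - u₀| ^ (-(1 / 2 : ℝ))) ≤ 4 * Real.sqrt (υ - 2) := by
    simpa [sub_zero] using hhle
  have : c₄ * ∫ u in (0 : ℝ)..υ - 2, |u - u₀| ^ (-(1 / 2 : ℝ)) ≤ c₄ * (4 * Real.sqrt (υ - 2)) :=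
    mul_le_mul_of_nonneg_left hhle' hc₄0
  rw [smul_eq_mul]
  linarith

/-! ## 2. Stub S2 `stub_junk` (registered signature, verbatim) -/

/-- **Stub S2 `stub_junk` of the line «far-gumbel» (theory g8, skeleton v5 sha16 `9e01753b`, item
`stmt-RiemannHypothesis-19465`; registered signature VERBATIM): the truncation junk is below the envelope,
`‖I(M,s) − J(M,υ,a)‖ ≤ farEnv M υ (a/υ²)` for `M ≥ 2·10¹⁸`, the far mode `υ` and `‖s‖ ≤ (7/20)M` (`a = farA M s`).**
Proof: the split (`norm_winI_sub_winJ_le`, part A) + the region integrals (`regionA_bound`, `regionB_bound`) + the budget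
(`junk_budget`, part D) + `farEnv_eq`. -/
theorem stub_junk : ∀ M : ℕ, 2 * 10 ^ 18 ≤ M → ∀ υ : ℝ,
    ((189 / 20 : ℝ) ≤ υ ∧ 4 * Real.pi * Real.exp (4 * υ) * υ = 2 * (M : ℝ) + 9 * υ) →
    ∀ s : ℂ, ‖s‖ ≤ (7 / 20 : ℝ) * M → ‖winI M s - winJ M υ (farA M s)‖ ≤ farEnv M υ (farA M s / (υ : ℂ) ^ 2) := by
  intro M hM υ hυ s hs
  have hM1 : 1 ≤ M := le_trans (by norm_num) hM
  have hυ0 : 0 < υ := by linarith [hυ.1]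
  have ha : ‖farA M s‖ ≤ 0.3502 * υ ^ 2 := norm_farA_le hM hυ hs
  have ha' : ‖farA M s‖ < (υ - 2) ^ 2 := lt_of_le_of_lt ha (by nlinarith [hυ.1])
  have hsplit := norm_winI_sub_winJ_le M hM1 s (show (2 : ℝ) < υ by linarith [hυ.1]) ha'
  have hA := regionA_bound hM1 hυ.1 ha
  have hB := regionB_bound hM1 hυ ha
  have hq := norm_one_add_div_sq_ge_loc hυ0 ha
  have hbud := junk_budget hM hυ hq (norm_nonneg _) ha
  rw [farEnv_eq M hυ0]
  linarith

end Summit.RiemannHypothesis.RiemannHypothesis.Theorems.JensenPolynomials.FarGumbel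

end
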